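import Summits.Schanuel.Schanuel.Theorems.ZilberEacFibreCurveZeros
import Summits.Schanuel.Schanuel.Theorems.ZilberEacGraphSurfaceAll
import HarnessLib

/-!
# Logarithmic strips, IV: Zariski density for fibre curves `P(x₀, y₀) = 0` over a graph base
# (the class `P ∈ ℂ[x₀, y₀]`, non-degenerate leading coefficient)

HONEST FRAMING.  Cell `pub-schanuel` (Zilber's Exponential-Algebraic Closedness, case ladder;
host summit Schanuel), seat 2, gen 17.  After `unprojectedDense_graphSurface` (every fibre
polynomial involving `y₁`), the surfaces of Mantova–Masser's case over a graph base `x₁ = p(x₀)`,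
`deg p ≥ 2`, that remain are `W = {x₁ = p(x₀), P(x₀, y₀) = 0}` with `P ∈ ℂ[x₀, y₀]`.  Here the
exponential points do not escape in `x₀` (they sit on the zeros of `P(z, e^z)`, in logarithmic
strips), but THEOREM G applies in the coordinate `x₁ = p(z)` as soon as `Re(lc(p)·i^d) ≠ 0`
(`tendsto_growth_eval_of_near_imag`): **`unprojectedDense_fibreCurveSurface`** — `deg p ≥ 2`,
`Re(lc(p)·i^{deg p}) ≠ 0`, `P` irreducible with two monomials of different `y₀`-degree ⟹ `W` has
Zariski-dense exponential points; with torus fibres over infinitely many base points it is in the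
case (`unprojectedDensityQuestion_instance_fibreCurve`); example `{x₁ = x₀², y₀² = x₀}`
(`e^{2z} = z`).  What is NOT covered (precisely): `Re(lc(p)·i^d) = 0` (e.g. `p = x³`, `p = ix²`),
where `Re p` along the strip is of lower order and may stay bounded on a degenerate subfamily (a
Schanuel-type question there).  NOT Schanuel's conjecture (neither used nor implied; EAC ⇏ SC);
`EC(3,2)` stays OPEN; instances of an OPEN question (PLMS 2024, §1 p. 5).
-/

noncomputable section

open Filter Topology Set Complex MvPolynomial
open Literature.NumberTheory.Transcendental Literature.ModelTheory.Zilber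
open Literature.ModelTheory.ExponentialFields

set_option linter.dupNamespace false

namespace Summit.Schanuel.Schanuel.Theorems

/-! ## Part A. The surface as a `W(p; P̃)` with `P̃ = P` lifted to `ℂ[x, y₀, y₁]` -/

section Lift

variable (p : Polynomial ℂ) (P : MvPolynomial (Fin 2) ℂ)

/-- Evaluating the lift `P̃ ∈ ℂ[x, y₀, y₁]` of `P ∈ ℂ[x, y₀]` ignores the last slot. -/
theorem eval_vec3_rename_castSucc (a b c : ℂ) :
    MvPolynomial.eval ![a, b, c] (rename (Fin.castSucc : Fin 2 → Fin 3) P) =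
      MvPolynomial.eval ![a, b] P := by
  rw [eval_rename]
  have e : ((![a, b, c] : Fin 3 → ℂ) ∘ Fin.castSucc : Fin 2 → ℂ) = ![a, b] := by
    funext i
    fin_cases i <;> rfl
  rw [e]

/-- `{x₁ = p(x₀), P(x₀, y₀) = 0} = W(p; P̃)`. -/
theorem fibreCurveSurface_eq :
    {w : Fin 2 ⊕ Fin 2 → ℂ | w (Sum.inl 1) = p.eval (w (Sum.inl 0)) ∧
      MvPolynomial.eval ![w (Sum.inl 0), w (Sum.inr 0)] P = 0} =
    {w : Fin 2 ⊕ Fin 2 → ℂ | w (Sum.inl 1) = p.eval (w (Sum.inl 0)) ∧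
      MvPolynomial.eval ![w (Sum.inl 0), w (Sum.inr 0), w (Sum.inr 1)]
        (rename (Fin.castSucc : Fin 2 → Fin 3) P) = 0} := by
  ext w
  simp only [Set.mem_setOf_eq, eval_vec3_rename_castSucc]

variable {P}

/-- The lift of an irreducible `P` is irreducible. -/
theorem irreducible_rename_castSucc₂ (hirr : Irreducible P) :
    Irreducible (rename (Fin.castSucc : Fin 2 → Fin 3) P) :=
  (prime_rename_of_injective (Fin.castSucc_injective 2)
    (UniqueFactorizationMonoid.irreducible_iff_prime.1 hirr)).irreducible

end Lift

/-! ## Part B. Density -/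

section Main

variable (p : Polynomial ℂ) {P : MvPolynomial (Fin 2) ℂ}

/-- **Zariski density for fibre curves over a graph base, non-degenerate leading term.**
`deg p ≥ 1` with `Re(lc(p) · i^{deg p}) ≠ 0` (for `deg p = 1`: a line of non-real slope); `P ∈ ℂ[x₀, y₀]` irreducible with two monomials of
different `y₀`-degree ⟹ the exponential points of `{x₁ = p(x₀), P(x₀, y₀) = 0} ⊆ ℂ² × ℂ²` are
Zariski dense (zeros of `P(z, e^z)` in a logarithmic strip; growth of `x₁ = p(z)`; THEOREM G in the
coordinate `x₁`).
[cite: MantovaMasser2023, §1 Further remarks, p. 5 (the question, open in general)] (new) -/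
theorem unprojectedDense_fibreCurveSurface (hd : 1 ≤ p.natDegree)
    (hre : (p.leadingCoeff * I ^ p.natDegree).re ≠ 0) (hirr : Irreducible P)
    (h1 : ∃ v ∈ P.support, ∃ v' ∈ P.support, v 1 ≠ v' 1) :
    UnprojectedDense {w : Fin 2 ⊕ Fin 2 → ℂ | w (Sum.inl 1) = p.eval (w (Sum.inl 0)) ∧
      MvPolynomial.eval ![w (Sum.inl 0), w (Sum.inr 0)] P = 0} := by
  obtain ⟨z, n, A, B, hA, hn, hz, hnear⟩ := exists_fibreCurve_zeros P h1
  have hgr := tendsto_growth_eval_of_near_imag p hd hre hn hA hnear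
  have hirr3 := irreducible_rename_castSucc₂ hirr
  rw [fibreCurveSurface_eq]
  set q : ℕ → Fin 2 ⊕ Fin 2 → ℂ := fun k =>
    Sum.elim ![z k, p.eval (z k)] ![exp (z k), exp (p.eval (z k))] with hq
  have hqS : ∀ k, q k ∈ {w : Fin 2 ⊕ Fin 2 → ℂ | w (Sum.inl 1) = p.eval (w (Sum.inl 0)) ∧
      MvPolynomial.eval ![w (Sum.inl 0), w (Sum.inr 0), w (Sum.inr 1)]
        (rename (Fin.castSucc : Fin 2 → Fin 3) P) = 0} := by
    intro k
    refine ⟨by simp [hq], ?_⟩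
    have e : (![q k (Sum.inl 0), q k (Sum.inr 0), q k (Sum.inr 1)] : Fin 3 → ℂ) =
        ![z k, exp (z k), exp (p.eval (z k))] := by
      simp [hq]
    rw [e, eval_vec3_rename_castSucc]
    exact hz k
  have hqΓ : ∀ k, q k ∈ expGraph ℂ 2 := by
    intro k
    rw [mem_expGraph_iff]
    intro i
    rw [Literature.ModelTheory.ExponentialFields.ExponentialRing.complex_exp_eq]
    fin_cases i <;> simp [hq]
  have hgr' : Tendsto (fun k => |(q k (Sum.inl 1)).re| / Real.log (2 + ‖q k (Sum.inl 1)‖))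
      atTop atTop := by
    refine hgr.congr fun k => ?_
    simp [hq]
  exact unprojectedDense_of_growth (isIrreducibleClosed_graphSurface p hirr3)
    (by rw [zariskiDim_graphSurface p hirr3]) 1 hqS hqΓ hgr'

/-- **Case certificate for fibre curves.**  `deg p ≥ 2`, `P` irreducible and `P(t, ·)` has a
nonzero root for infinitely many `t` ⟹ `{x₁ = p(x₀), P(x₀, y₀) = 0}` is in Mantova–Masser's case
(dim-π-S-1-free). (new) -/
theorem mmCase_fibreCurveSurface (hd : 2 ≤ p.natDegree) (hirr : Irreducible P)
    (hfib : Set.Infinite {t : ℂ | ∃ y : ℂ, y ≠ 0 ∧ MvPolynomial.eval ![t, y] P = 0}) :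
    MMCaseDimPiOneFree {w : Fin 2 ⊕ Fin 2 → ℂ | w (Sum.inl 1) = p.eval (w (Sum.inl 0)) ∧
      MvPolynomial.eval ![w (Sum.inl 0), w (Sum.inr 0)] P = 0} := by
  rw [fibreCurveSurface_eq]
  refine mmCase_graphSurface p _ hd (irreducible_rename_castSucc₂ hirr) (hfib.mono ?_)
  rintro t ⟨y, hy, hty⟩
  refine ⟨![y, 1], by simpa using hy, by simp, ?_⟩
  have e : (![t, (![y, 1] : Fin 2 → ℂ) 0, (![y, 1] : Fin 2 → ℂ) 1] : Fin 3 → ℂ) = ![t, y, 1] := by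
    funext i; fin_cases i <;> rfl
  rw [e, eval_vec3_rename_castSucc]
  exact hty

/-- **Mantova–Masser's question on the fibre-curve family: case ∧ dense.**
[cite: MantovaMasser2023, §1 Further remarks, p. 5 (the question, open in general)] (new) -/
theorem unprojectedDensityQuestion_instance_fibreCurve (hd : 2 ≤ p.natDegree)
    (hre : (p.leadingCoeff * I ^ p.natDegree).re ≠ 0) (hirr : Irreducible P)
    (h1 : ∃ v ∈ P.support, ∃ v' ∈ P.support, v 1 ≠ v' 1)
    (hfib : Set.Infinite {t : ℂ | ∃ y : ℂ, y ≠ 0 ∧ MvPolynomial.eval ![t, y] P = 0}) :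
    MMCaseDimPiOneFree {w : Fin 2 ⊕ Fin 2 → ℂ | w (Sum.inl 1) = p.eval (w (Sum.inl 0)) ∧
        MvPolynomial.eval ![w (Sum.inl 0), w (Sum.inr 0)] P = 0} ∧
      UnprojectedDense {w : Fin 2 ⊕ Fin 2 → ℂ | w (Sum.inl 1) = p.eval (w (Sum.inl 0)) ∧
        MvPolynomial.eval ![w (Sum.inl 0), w (Sum.inr 0)] P = 0} :=
  ⟨mmCase_fibreCurveSurface p hd hirr hfib,
    unprojectedDense_fibreCurveSurface p (by omega) hre hirr h1⟩

end Main

/-! ## Part C. Example: `{x₁ = x₀², y₀² = x₀}` (`e^{2z} = z`) -/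

section Example

/-- `y₀² - x₀` is irreducible (Eisenstein at `x₀`: it is the cyclic-cover polynomial
`X₂² - X₁`). -/
theorem irreducible_X1_sq_sub_X0 : Irreducible (X 1 ^ 2 - X 0 : MvPolynomial (Fin 2) ℂ) := by
  have e : (X 1 ^ 2 - X 0 : MvPolynomial (Fin 2) ℂ) =
      cyclicCoverPoly 2 (X 0 : MvPolynomial (Fin 1) ℂ) := by
    rw [cyclicCoverPoly, rename_X]; rfl
  rw [e]
  refine irreducible_cyclicCoverPoly two_pos (π := X 0) MvPolynomial.X_prime dvd_rfl ?_
  rintro ⟨u, hu⟩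
  have h1 : (1 : MvPolynomial (Fin 1) ℂ) = X 0 * u := by
    have h2 : (X 0 : MvPolynomial (Fin 1) ℂ) * 1 = X 0 * (X 0 * u) := by rw [mul_one, ← mul_assoc, ← pow_two]; exact hu
    exact mul_left_cancel₀ (MvPolynomial.X_ne_zero 0) h2
  have h3 := congrArg (MvPolynomial.eval ![(0 : ℂ)]) h1
  simp at h3

/-- `y₀² - x₀` has the monomials `y₀²` and `x₀`, of different `y₀`-degree. -/
theorem X1_sq_sub_X0_support_pair :
    ∃ v ∈ (X 1 ^ 2 - X 0 : MvPolynomial (Fin 2) ℂ).support,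
      ∃ v' ∈ (X 1 ^ 2 - X 0 : MvPolynomial (Fin 2) ℂ).support, v 1 ≠ v' 1 := by
  classical
  have hne : (Finsupp.single (1 : Fin 2) 2 : Fin 2 →₀ ℕ) ≠ Finsupp.single 0 1 := by
    intro h; have := DFunLike.congr_fun h 1; simp at this
  refine ⟨Finsupp.single 1 2, ?_, Finsupp.single 0 1, ?_, ?_⟩
  · rw [MvPolynomial.mem_support_iff, MvPolynomial.coeff_sub, MvPolynomial.coeff_X_pow,
      MvPolynomial.coeff_X, if_pos rfl, if_neg hne.symm]
    norm_num
  · rw [MvPolynomial.mem_support_iff, MvPolynomial.coeff_sub, MvPolynomial.coeff_X_pow,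
      MvPolynomial.coeff_X, if_neg hne, if_pos rfl]
    norm_num
  · simp

/-- Nonzero fibre roots of `y₀² = x₀` over every `t ≠ 0`. -/
theorem X1_sq_sub_X0_fibres_infinite :
    Set.Infinite {t : ℂ | ∃ y : ℂ, y ≠ 0 ∧
      MvPolynomial.eval ![t, y] (X 1 ^ 2 - X 0 : MvPolynomial (Fin 2) ℂ) = 0} := by
  refine ((Set.finite_singleton (0 : ℂ)).infinite_compl).mono ?_
  intro t ht
  obtain ⟨y, hy⟩ := IsAlgClosed.exists_pow_nat_eq t two_pos
  have hy0 : y ≠ 0 := by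
    rintro rfl
    rw [zero_pow two_ne_zero] at hy
    exact ht hy.symm
  refine ⟨y, hy0, ?_⟩
  simp [hy]

/-- **Example.**  The surface `{x₁ = x₀², y₀² = x₀} ⊆ ℂ² × ℂ²` (fibre curve in the
`(x₀, y₀)`-plane, `y₁` free) is in Mantova–Masser's case and its exponential points
`(z, z², e^z, e^{z²})`, `e^{2z} = z`, are Zariski dense. (new) -/
theorem unprojectedDensityQuestion_instance_parabola_y0sq_eq_x0 :
    MMCaseDimPiOneFree {w : Fin 2 ⊕ Fin 2 → ℂ |
        w (Sum.inl 1) = (Polynomial.X ^ 2 : Polynomial ℂ).eval (w (Sum.inl 0)) ∧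
        MvPolynomial.eval ![w (Sum.inl 0), w (Sum.inr 0)]
          (X 1 ^ 2 - X 0 : MvPolynomial (Fin 2) ℂ) = 0} ∧
      UnprojectedDense {w : Fin 2 ⊕ Fin 2 → ℂ |
        w (Sum.inl 1) = (Polynomial.X ^ 2 : Polynomial ℂ).eval (w (Sum.inl 0)) ∧
        MvPolynomial.eval ![w (Sum.inl 0), w (Sum.inr 0)]
          (X 1 ^ 2 - X 0 : MvPolynomial (Fin 2) ℂ) = 0} := by
  have hd : 2 ≤ (Polynomial.X ^ 2 : Polynomial ℂ).natDegree := by simp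
  have hre : ((Polynomial.X ^ 2 : Polynomial ℂ).leadingCoeff *
      I ^ (Polynomial.X ^ 2 : Polynomial ℂ).natDegree).re ≠ 0 := by
    simp [Complex.I_sq]
  exact unprojectedDensityQuestion_instance_fibreCurve (Polynomial.X ^ 2) hd hre
    irreducible_X1_sq_sub_X0 X1_sq_sub_X0_support_pair X1_sq_sub_X0_fibres_infinite

/-- The same surface in plain coordinates. (new) -/
theorem unprojectedDense_parabola_y0sq_eq_x0 :
    UnprojectedDense {w : Fin 2 ⊕ Fin 2 → ℂ |
      w (Sum.inl 1) = w (Sum.inl 0) ^ 2 ∧ w (Sum.inr 0) ^ 2 = w (Sum.inl 0)} := by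
  have h := unprojectedDensityQuestion_instance_parabola_y0sq_eq_x0.2
  have hset : {w : Fin 2 ⊕ Fin 2 → ℂ |
        w (Sum.inl 1) = (Polynomial.X ^ 2 : Polynomial ℂ).eval (w (Sum.inl 0)) ∧
        MvPolynomial.eval ![w (Sum.inl 0), w (Sum.inr 0)]
          (X 1 ^ 2 - X 0 : MvPolynomial (Fin 2) ℂ) = 0} =
      {w : Fin 2 ⊕ Fin 2 → ℂ | w (Sum.inl 1) = w (Sum.inl 0) ^ 2 ∧
        w (Sum.inr 0) ^ 2 = w (Sum.inl 0)} := by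
    ext w
    simp only [Set.mem_setOf_eq, Polynomial.eval_pow, Polynomial.eval_X, map_sub, map_pow,
      MvPolynomial.eval_X, Matrix.cons_val_zero, Matrix.cons_val_one, sub_eq_zero]
  rw [← hset]
  exact h

end Example

end Summit.Schanuel.Schanuel.Theorems
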